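import Literature.NumberTheory.LFunctions.Zhang2022.DirichletNeumannForm
import Literature.Analysis.Fourier.ErdosTuranDiscrepancy

/-!
# The glued main-term form `𝔅` is positive semidefinite (repair-cell theorem O15)

Topic `Literature/NumberTheory/LFunctions`, grouping with the other `Zhang2022/*` files (autopsy of
Y. Zhang, *Discrete mean estimates and the Landau–Siegel zero*, arXiv:2211.02515 (2022)
[Zhang2022LandauSiegel]). This file makes NO claim about that manuscript's Theorems 1–2 (the
repair cell's verdict is negative: the printed inequality (8.24) fails, `Zhang2022.not_ineq824`).
It proves, kernel-checked, the cell's STRUCTURAL theorem about the main term (PROOF-O15 of the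
pub-zhang cell, = STRUCTURE.md §8 check (iv)): the Hermitian form that the glued `(A)`-world
discrete mean value induces on coefficient profiles,

  `𝔅(g,g) = (8/π)‖g′‖² + 48 Im⟨g′,g⟩ + 88π‖g‖² + 48π² Im⟨S′,S⟩ − 24π Re(Ī(a₀+a₁)) + 16 Im(a₀ā₁)`,
  `S(y) = ∫₀ʸ g`, `I = S(1)`, `a₀ = g(0)`, `a₁ = g(1)`, `⟨u,v⟩ = ∫₀¹ u v̄`

(STRUCTURE.md (4.1); here `mainTermForm g g'`, resp. `mainTermFormJet P` for a jet `P = (S,g,g′)`),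
is POSITIVE SEMIDEFINITE on `C¹[0,1]`, and equals a weighted sum of squares whose kernel is described
by the vanishing of explicit Fourier coefficients. Consequently `|𝔅(𝔤,f)|² ≤ 𝔅(𝔤,𝔤)𝔅(f,f)` for all
profiles: no choice of profile makes the main term negative — the quantitative reason the cell
records for why the manuscript's `§8` comparison cannot come out the way (8.24) needs.

## Statements

* `mainTermFormJet_eq` **(T1, demodulation)**: for a `C²` jet `P = (S, g, g′)` with `S(0) = 0`,
  `𝔅 = (8/π)·Re Q̃(R,R)`, where `R = e^{3πiy/2}S` (`Jet2.modulate`) and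
  `Q̃(U,V) = ∫₀¹(u″v̄″ − (5π²/2)u′v̄′ + (9π⁴/16)uv̄) + (3π²/4)(u(1)v̄′(1) + u′(1)v̄(1))
   − π(u′(0)v̄′(1) + u′(1)v̄′(0))` (`dnPolar`; on the diagonal this is PROOF-O15's `Q̃(R)`).
* `dnPolar_rsJet_left` **(radical)**: `Q̃(R*, V) = 0` for `R* = cos(πy/2) − cos(3πy/2)` and every
  `C²` jet `V`; hence `Q̃(R − tR*, R − tR*) = Q̃(R,R)` (`dnPolar_subSmul_rsJet`), and with
  `t = −R′(1)/(2π)` the reduced `R₁ = R − tR*` (`rsReduce`) has `R₁(0) = R(0)`, `R₁′(1) = 0`, so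
  `Q̃(R,R) = Q(R₁)` is the Dirichlet–Neumann form of `DirichletNeumannForm.lean`
  (`dnPolar_self_eq_dnForm_rsReduce`).
* `dnPolar_self_hasSum`, `dnPolar_self_re_nonneg`, `dnPolar_self_re_eq_zero_iff` **(T2–T4 for `Q̃`)**:
  for `R ∈ C²`, `R(0) = 0`: `Re Q̃(R,R) = ∑ₖ π⁴(k−1)k(k+1)(k+2)|c_k(R₁)|² ≥ 0`, `Im Q̃(R,R) = 0`,
  and `Q̃(R,R) = 0 ↔ c_k(R₁) = 0 ∀ k ≥ 2` (`c_k` = quarter-wave sine coefficients `qwCoeff`).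
* `mainTermForm_nonneg` **(O15)**: `0 ≤ 𝔅(g,g)` for every `g ∈ C¹[0,1]` (`IsC1OnUnitInterval g g'`;
  `S` is the primitive, `primitiveJet`, `C²` by the fundamental theorem of calculus);
  `mainTermForm_hasSum` (the sum-of-squares expansion, PROOF-O15 (T2)) and
  `mainTermForm_eq_zero_iff` (kernel in coefficient form, (T4)).

## Method

Everything is integration by parts on `[0,1]` (`integral_deriv_mul_unitInterval`) plus the
diagonalisation of `DirichletNeumannForm.lean`: (T1) is the pointwise identity
`|E|²·(demodulated integrand)` (`dnPolarIntegrand_modulate`, `|E| = 1`, the `|S|²` coefficient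
`c⁴ − (5π²/2)c² + 9π⁴/16` vanishing at `c = 3π/2`) followed by the two by-parts identities
`∫ g′S̄ = a₁Ī − ‖g‖²`, `∫ S ḡ′ = Iā₁ − ‖g‖²` and the boundary values `E(0) = 1`, `E(1) = −i`; the
radical lemma is three integrations by parts against the explicit `R*`, which solves the
Euler–Lagrange equation `R⁗ + (5π²/2)R″ + (9π⁴/16)R = 0` (`rsF_ode`) together with all natural
boundary conditions (`rsF_values`).

NOT here: the `H¹`/`H²` (rather than `C¹`/`C²`) versions, and the translation of the kernel
condition into `g ∈ span{e^{−iπy}, e^{−2iπy}, e^{−3iπy}}` (PROOF-O15 (T4), second form). The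
mathematics is elementary calculus, tagged [folklore]; the STATEMENT (the form `𝔅` and its role)
is the repair cell's, documented in pub-zhang STRUCTURE.md §4 and PROOF-O15.md.
-/

noncomputable section

open MeasureTheory Set intervalIntegral
open scoped Real ComplexConjugate

namespace Literature.NumberTheory.LFunctions.Zhang2022

open Literature.Analysis.Fourier

/-! ### 2-jets and the polar Dirichlet–Neumann form with boundary terms -/

/-- A 2-jet on `[0,1]`: a function `f` with two marked companions `f'`, `f''` (pure data; that they
are the derivatives is the predicate `IsC2OnUnitInterval J.f J.f' J.f''`). [folklore] -/
structure Jet2 where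
  /-- the function -/
  f : ℝ → ℂ
  /-- its first derivative -/
  f' : ℝ → ℂ
  /-- its second derivative -/
  f'' : ℝ → ℂ

/-- `U - t•V`, componentwise. [folklore] -/
def Jet2.subSmul (U : Jet2) (t : ℂ) (V : Jet2) : Jet2 :=
  ⟨fun x => U.f x - t * V.f x, fun x => U.f' x - t * V.f' x, fun x => U.f'' x - t * V.f'' x⟩

/-- `C²`-regularity is preserved by `U - t•V`. [folklore] -/
theorem Jet2.isC2_subSmul {U V : Jet2} (hU : IsC2OnUnitInterval U.f U.f' U.f'')
    (hV : IsC2OnUnitInterval V.f V.f' V.f'') (t : ℂ) :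
    IsC2OnUnitInterval (U.subSmul t V).f (U.subSmul t V).f' (U.subSmul t V).f'' :=
  ⟨hU.cont.sub (continuousOn_const.mul hV.cont), hU.cont'.sub (continuousOn_const.mul hV.cont'),
    hU.cont''.sub (continuousOn_const.mul hV.cont''),
    fun x hx => (hU.hasDeriv x hx).sub ((hV.hasDeriv x hx).const_mul t),
    fun x hx => (hU.hasDeriv' x hx).sub ((hV.hasDeriv' x hx).const_mul t)⟩

/-- The integrand `u″v̄″ − (5π²/2)u′v̄′ + (9π⁴/16)uv̄` of the polar Dirichlet–Neumann form.
[folklore] -/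
def dnPolarIntegrand (U V : Jet2) (x : ℝ) : ℂ :=
  U.f'' x * conj (V.f'' x) - (5 * π ^ 2 / 2 : ℝ) * (U.f' x * conj (V.f' x))
    + (9 * π ^ 4 / 16 : ℝ) * (U.f x * conj (V.f x))

/-- The boundary part `(3π²/4)(u(1)v̄′(1) + u′(1)v̄(1)) − π(u′(0)v̄′(1) + u′(1)v̄′(0))` of the polar
form `Q̃` (PROOF-O15 §2). [folklore] -/
def dnBoundary (U V : Jet2) : ℂ :=
  (3 * π ^ 2 / 4 : ℝ) * (U.f 1 * conj (V.f' 1) + U.f' 1 * conj (V.f 1))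
    - (π : ℝ) * (U.f' 0 * conj (V.f' 1) + U.f' 1 * conj (V.f' 0))

/-- The polar form `Q̃(U,V) = ∫₀¹ (u″v̄″ − (5π²/2)u′v̄′ + (9π⁴/16)uv̄) + boundary terms`, whose
diagonal `Q̃(R) = Q̃(R,R) = ‖R″‖² − (5π²/2)‖R′‖² + (9π⁴/16)‖R‖² + (3π²/2)Re(R(1)R̄′(1))
− 2π Re(R′(0)R̄′(1))` is the demodulated main-term form of PROOF-O15 (T1). [folklore] -/
def dnPolar (U V : Jet2) : ℂ := (∫ x in (0:ℝ)..1, dnPolarIntegrand U V x) + dnBoundary U V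

variable {U V W : Jet2}

/-- Continuity of the integrand for `C²` jets. [folklore] -/
theorem continuousOn_dnPolarIntegrand (hU : IsC2OnUnitInterval U.f U.f' U.f'')
    (hV : IsC2OnUnitInterval V.f V.f' V.f'') : ContinuousOn (dnPolarIntegrand U V) (Icc 0 1) := by
  have h1 : ContinuousOn (fun x => U.f'' x * conj (V.f'' x)) (Icc 0 1) :=
    hU.cont''.mul (continuousOn_conj_comp hV.cont'')
  have h2 : ContinuousOn (fun x => U.f' x * conj (V.f' x)) (Icc 0 1) :=
    hU.cont'.mul (continuousOn_conj_comp hV.cont')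
  have h3 : ContinuousOn (fun x => U.f x * conj (V.f x)) (Icc 0 1) :=
    hU.cont.mul (continuousOn_conj_comp hV.cont)
  have h : ContinuousOn (fun x => U.f'' x * conj (V.f'' x)
      - ((5 * π ^ 2 / 2 : ℝ) : ℂ) * (U.f' x * conj (V.f' x))
      + ((9 * π ^ 4 / 16 : ℝ) : ℂ) * (U.f x * conj (V.f x))) (Icc 0 1) :=
    (h1.sub (continuousOn_const.mul h2)).add (continuousOn_const.mul h3)
  exact h

/-- Interval integrability of the integrand for `C²` jets. [folklore] -/
theorem intervalIntegrable_dnPolarIntegrand (hU : IsC2OnUnitInterval U.f U.f' U.f'')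
    (hV : IsC2OnUnitInterval V.f V.f' V.f'') :
    IntervalIntegrable (dnPolarIntegrand U V) volume 0 1 :=
  (continuousOn_dnPolarIntegrand hU hV).intervalIntegrable_of_Icc zero_le_one

/-- Linearity of `Q̃` in the first argument along `U - t•V`. [folklore] -/
theorem dnPolar_subSmul_left (hU : IsC2OnUnitInterval U.f U.f' U.f'')
    (hV : IsC2OnUnitInterval V.f V.f' V.f'') (hW : IsC2OnUnitInterval W.f W.f' W.f'') (t : ℂ) :
    dnPolar (U.subSmul t V) W = dnPolar U W - t * dnPolar V W := by
  have hpt : ∀ x, dnPolarIntegrand (U.subSmul t V) W x =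
      dnPolarIntegrand U W x - t * dnPolarIntegrand V W x := by
    intro x; simp only [dnPolarIntegrand, Jet2.subSmul]; ring
  rw [dnPolar, dnPolar, dnPolar, intervalIntegral.integral_congr (fun x _ => hpt x),
    intervalIntegral.integral_sub (intervalIntegrable_dnPolarIntegrand hU hW)
      ((intervalIntegrable_dnPolarIntegrand hV hW).const_mul t),
    intervalIntegral.integral_const_mul]
  simp only [dnBoundary, Jet2.subSmul]
  ring

/-- Conjugate-linearity of `Q̃` in the second argument along `U - t•V`. [folklore] -/
theorem dnPolar_subSmul_right (hW : IsC2OnUnitInterval W.f W.f' W.f'')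
    (hU : IsC2OnUnitInterval U.f U.f' U.f'') (hV : IsC2OnUnitInterval V.f V.f' V.f'') (t : ℂ) :
    dnPolar W (U.subSmul t V) = dnPolar W U - conj t * dnPolar W V := by
  have hpt : ∀ x, dnPolarIntegrand W (U.subSmul t V) x =
      dnPolarIntegrand W U x - conj t * dnPolarIntegrand W V x := by
    intro x; simp only [dnPolarIntegrand, Jet2.subSmul, map_sub, map_mul]; ring
  rw [dnPolar, dnPolar, dnPolar, intervalIntegral.integral_congr (fun x _ => hpt x),
    intervalIntegral.integral_sub (intervalIntegrable_dnPolarIntegrand hW hU)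
      ((intervalIntegrable_dnPolarIntegrand hW hV).const_mul (conj t)),
    intervalIntegral.integral_const_mul]
  simp only [dnBoundary, Jet2.subSmul, map_sub, map_mul]
  ring

/-- Hermitian symmetry: `Q̃(V,U) = conj Q̃(U,V)`. [folklore] -/
theorem dnPolar_swap (U V : Jet2) : dnPolar V U = conj (dnPolar U V) := by
  have hpt : ∀ x, dnPolarIntegrand V U x = conj (dnPolarIntegrand U V x) := by
    intro x
    simp only [dnPolarIntegrand, map_add, map_sub, map_mul, Complex.conj_conj, Complex.conj_ofReal]
    ring
  rw [dnPolar, dnPolar, map_add, ← intervalIntegral_conj,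
    intervalIntegral.integral_congr (fun x _ => hpt x)]
  simp only [dnBoundary, map_add, map_sub, map_mul, Complex.conj_conj, Complex.conj_ofReal]
  ring

/-- On the diagonal and under `u′(1) = 0` the boundary terms vanish and `Q̃(U,U)` is the
Dirichlet–Neumann form `Q(u)` of `DirichletNeumannForm.lean`. [folklore] -/
theorem dnPolar_self_eq_dnForm (hU : IsC2OnUnitInterval U.f U.f' U.f'')
    (h1 : U.f' 1 = 0) : dnPolar U U = (dnForm U.f U.f' U.f'' : ℂ) := by
  have hI : ∀ {h : ℝ → ℂ}, ContinuousOn h (Icc 0 1) → IntervalIntegrable h volume 0 1 :=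
    fun hh => hh.intervalIntegrable_of_Icc zero_le_one
  have i1 : IntervalIntegrable (fun x => U.f'' x * conj (U.f'' x)) volume 0 1 :=
    hI (hU.cont''.mul (continuousOn_conj_comp hU.cont''))
  have i2 : IntervalIntegrable (fun x => U.f' x * conj (U.f' x)) volume 0 1 :=
    hI (hU.cont'.mul (continuousOn_conj_comp hU.cont'))
  have i3 : IntervalIntegrable (fun x => U.f x * conj (U.f x)) volume 0 1 :=
    hI (hU.cont.mul (continuousOn_conj_comp hU.cont))
  have hsplit : ∫ x in (0:ℝ)..1, dnPolarIntegrand U U x =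
      (∫ x in (0:ℝ)..1, U.f'' x * conj (U.f'' x))
        - ((5 * π ^ 2 / 2 : ℝ) : ℂ) * (∫ x in (0:ℝ)..1, U.f' x * conj (U.f' x))
        + ((9 * π ^ 4 / 16 : ℝ) : ℂ) * ∫ x in (0:ℝ)..1, U.f x * conj (U.f x) := by
    rw [← intervalIntegral.integral_const_mul, ← intervalIntegral.integral_const_mul,
      ← intervalIntegral.integral_sub i1 (i2.const_mul _),
      ← intervalIntegral.integral_add (i1.sub (i2.const_mul _)) (i3.const_mul _)]
    rfl
  rw [dnPolar, hsplit, integral_mul_conj_eq_ofReal, integral_mul_conj_eq_ofReal,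
    integral_mul_conj_eq_ofReal, dnBoundary, h1, dnForm]
  simp only [map_zero, mul_zero, zero_mul, add_zero, sub_zero]
  push_cast
  ring

/-! ### The radical direction `R* = cos(πy/2) − cos(3πy/2)` -/

/-- `qwFreq 0 = π/2`. [folklore] -/
theorem qwFreq_zero : qwFreq 0 = π / 2 := by simp [qwFreq]; ring

/-- `qwFreq 1 = 3π/2`. [folklore] -/
theorem qwFreq_one : qwFreq 1 = 3 * π / 2 := by simp [qwFreq]; ring

/-- `sin((k+½)π) = (-1)^k`. [folklore] -/
theorem sin_qwFreq (k : ℕ) : Real.sin (qwFreq k) = (-1) ^ k := by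
  rw [qwFreq, show ((k : ℝ) + 1 / 2) * π = k * π + π / 2 by ring, Real.sin_add_pi_div_two,
    Real.cos_nat_mul_pi]

/-- `R*(y) = cos(πy/2) − cos(3πy/2)` (complex-valued). [folklore] -/
def rsF (y : ℝ) : ℂ := ((Real.cos (qwFreq 0 * y) - Real.cos (qwFreq 1 * y) : ℝ) : ℂ)
/-- `R*′`. [folklore] -/
def rsF1 (y : ℝ) : ℂ :=
  ((-(qwFreq 0 * Real.sin (qwFreq 0 * y)) + qwFreq 1 * Real.sin (qwFreq 1 * y) : ℝ) : ℂ)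
/-- `R*″`. [folklore] -/
def rsF2 (y : ℝ) : ℂ :=
  ((-(qwFreq 0 ^ 2 * Real.cos (qwFreq 0 * y)) + qwFreq 1 ^ 2 * Real.cos (qwFreq 1 * y) : ℝ) : ℂ)
/-- `R*‴`. [folklore] -/
def rsF3 (y : ℝ) : ℂ :=
  ((qwFreq 0 ^ 3 * Real.sin (qwFreq 0 * y) - qwFreq 1 ^ 3 * Real.sin (qwFreq 1 * y) : ℝ) : ℂ)
/-- `R*⁗`. [folklore] -/
def rsF4 (y : ℝ) : ℂ :=
  ((qwFreq 0 ^ 4 * Real.cos (qwFreq 0 * y) - qwFreq 1 ^ 4 * Real.cos (qwFreq 1 * y) : ℝ) : ℂ)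

/-- The radical jet `R* = (R*, R*′, R*″)`. [folklore] -/
def rsJet : Jet2 := ⟨rsF, rsF1, rsF2⟩

/-- `R*` is continuous. [folklore] -/
theorem continuous_rsF : Continuous rsF := by unfold rsF; fun_prop
/-- `R*′` is continuous. [folklore] -/
theorem continuous_rsF1 : Continuous rsF1 := by unfold rsF1; fun_prop
/-- `R*″` is continuous. [folklore] -/
theorem continuous_rsF2 : Continuous rsF2 := by unfold rsF2; fun_prop
/-- `R*‴` is continuous. [folklore] -/
theorem continuous_rsF3 : Continuous rsF3 := by unfold rsF3; fun_prop
/-- `R*⁗` is continuous. [folklore] -/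
theorem continuous_rsF4 : Continuous rsF4 := by unfold rsF4; fun_prop

/-- `(R*)′ = R*′`. [folklore] -/
theorem hasDerivAt_rsF (x : ℝ) : HasDerivAt rsF (rsF1 x) x := by
  have h := ((hasDerivAt_cos_mul (qwFreq 0) x).sub (hasDerivAt_cos_mul (qwFreq 1) x)).ofReal_comp
  refine (h.congr_deriv ?_)
  simp only [rsF1]; push_cast; ring

/-- `(R*′)′ = R*″`. [folklore] -/
theorem hasDerivAt_rsF1 (x : ℝ) : HasDerivAt rsF1 (rsF2 x) x := by
  have h := (((hasDerivAt_sin_mul (qwFreq 0) x).const_mul (qwFreq 0)).neg.add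
    ((hasDerivAt_sin_mul (qwFreq 1) x).const_mul (qwFreq 1))).ofReal_comp
  refine (h.congr_deriv ?_)
  simp only [rsF2]; push_cast; ring

/-- `(R*″)′ = R*‴`. [folklore] -/
theorem hasDerivAt_rsF2 (x : ℝ) : HasDerivAt rsF2 (rsF3 x) x := by
  have h := (((hasDerivAt_cos_mul (qwFreq 0) x).const_mul (qwFreq 0 ^ 2)).neg.add
    ((hasDerivAt_cos_mul (qwFreq 1) x).const_mul (qwFreq 1 ^ 2))).ofReal_comp
  refine (h.congr_deriv ?_)
  simp only [rsF3]; push_cast; ring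

/-- `(R*‴)′ = R*⁗`. [folklore] -/
theorem hasDerivAt_rsF3 (x : ℝ) : HasDerivAt rsF3 (rsF4 x) x := by
  have h := (((hasDerivAt_sin_mul (qwFreq 0) x).const_mul (qwFreq 0 ^ 3)).sub
    ((hasDerivAt_sin_mul (qwFreq 1) x).const_mul (qwFreq 1 ^ 3))).ofReal_comp
  refine (h.congr_deriv ?_)
  simp only [rsF4]; push_cast; ring

/-- `R*` is a `C²` jet on `[0,1]`. [folklore] -/
theorem isC2_rsJet : IsC2OnUnitInterval rsJet.f rsJet.f' rsJet.f'' :=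
  ⟨continuous_rsF.continuousOn, continuous_rsF1.continuousOn, continuous_rsF2.continuousOn,
    fun x _ => hasDerivAt_rsF x, fun x _ => hasDerivAt_rsF1 x⟩

/-- The Euler–Lagrange equation `R*⁗ + (5π²/2)R*″ + (9π⁴/16)R* = 0` (characteristic roots
`±iπ/2, ±3iπ/2`). [folklore] -/
theorem rsF_ode (y : ℝ) :
    rsF4 y = -((5 * π ^ 2 / 2 : ℝ) : ℂ) * rsF2 y - ((9 * π ^ 4 / 16 : ℝ) : ℂ) * rsF y := by
  simp only [rsF4, rsF2, rsF, qwFreq_zero, qwFreq_one]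
  push_cast
  ring

/-- Boundary values of the radical jet: `R*(0) = R*(1) = 0`, `R*′(0) = 0`, `R*′(1) = −2π`,
`R*″(0) = 2π²`, `R*″(1) = 0`, `R*‴(0) = 0`, `R*‴(1) = 7π³/2`. [folklore] -/
theorem rsF_values :
    rsF 0 = 0 ∧ rsF 1 = 0 ∧ rsF1 0 = 0 ∧ rsF1 1 = -2 * π ∧ rsF2 0 = 2 * π ^ 2 ∧ rsF2 1 = 0 ∧
      rsF3 0 = 0 ∧ rsF3 1 = 7 * π ^ 3 / 2 := by
  have c0 := cos_qwFreq 0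
  have c1 := cos_qwFreq 1
  have s0 := sin_qwFreq 0
  have s1 := sin_qwFreq 1
  simp only [pow_zero, pow_one] at s0 s1
  refine ⟨?_, ?_, ?_, ?_, ?_, ?_, ?_, ?_⟩ <;>
    simp only [rsF, rsF1, rsF2, rsF3, mul_zero, mul_one, Real.cos_zero, Real.sin_zero, c0, c1, s0,
      s1] <;> (try simp only [qwFreq_zero, qwFreq_one]) <;> push_cast <;> ring


/-- **`R*` is in the radical of `Q̃`**: `Q̃(R*, V) = 0` for every `C²` jet `V` (no boundary
conditions on `V`). Three integrations by parts move all derivatives onto `R*`; the bulk becomes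
`∫ (R*⁗ + (5π²/2)R*″ + (9π⁴/16)R*) v̄ = 0` and the boundary values of `R*` make the remaining
terms cancel the boundary part of `Q̃` exactly (PROOF-O15 §2: `R*` satisfies the Euler–Lagrange
equation and all three natural boundary conditions). [folklore] -/
theorem dnPolar_rsJet_left (hV : IsC2OnUnitInterval V.f V.f' V.f'') : dnPolar rsJet V = 0 := by
  obtain ⟨v0, v1, v1_0, v1_1, v2_0, v2_1, v3_0, v3_1⟩ := rsF_values
  have hI : ∀ {h : ℝ → ℂ}, ContinuousOn h (Icc 0 1) → IntervalIntegrable h volume 0 1 :=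
    fun hh => hh.intervalIntegrable_of_Icc zero_le_one
  have cv := continuousOn_conj_comp hV.cont
  have cv' := continuousOn_conj_comp hV.cont'
  have cv'' := continuousOn_conj_comp hV.cont''
  have iA : IntervalIntegrable (fun x => rsF3 x * conj (V.f' x)) volume 0 1 :=
    hI (continuous_rsF3.continuousOn.mul cv')
  have iB : IntervalIntegrable (fun x => rsF2 x * conj (V.f'' x)) volume 0 1 :=
    hI (continuous_rsF2.continuousOn.mul cv'')
  have iC : IntervalIntegrable (fun x => rsF4 x * conj (V.f x)) volume 0 1 :=
    hI (continuous_rsF4.continuousOn.mul cv)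
  have iD : IntervalIntegrable (fun x => rsF2 x * conj (V.f x)) volume 0 1 :=
    hI (continuous_rsF2.continuousOn.mul cv)
  have iE : IntervalIntegrable (fun x => rsF1 x * conj (V.f' x)) volume 0 1 :=
    hI (continuous_rsF1.continuousOn.mul cv')
  have iF : IntervalIntegrable (fun x => rsF x * conj (V.f x)) volume 0 1 :=
    hI (continuous_rsF.continuousOn.mul cv)
  -- (a) u = R*″, v = v̄′
  have bpa := integral_deriv_mul_unitInterval (u := rsF2) (v := fun x => conj (V.f' x))
    (u' := rsF3) (v' := fun x => conj (V.f'' x)) continuous_rsF2.continuousOn cv'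
    (fun x _ => hasDerivAt_rsF2 x) (fun x hx => hasDerivAt_conj_comp (hV.hasDeriv' x hx))
    (continuous_rsF3.intervalIntegrable 0 1) (hI cv'')
  rw [v2_1, v2_0, intervalIntegral.integral_add iA iB] at bpa
  -- (b) u = R*‴, v = v̄
  have bpb := integral_deriv_mul_unitInterval (u := rsF3) (v := fun x => conj (V.f x))
    (u' := rsF4) (v' := fun x => conj (V.f' x)) continuous_rsF3.continuousOn cv
    (fun x _ => hasDerivAt_rsF3 x) (fun x hx => hasDerivAt_conj_comp (hV.hasDeriv x hx))
    (continuous_rsF4.intervalIntegrable 0 1) (hI cv')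
  rw [v3_1, v3_0, intervalIntegral.integral_add iC iA] at bpb
  -- (c) u = R*′, v = v̄
  have bpc := integral_deriv_mul_unitInterval (u := rsF1) (v := fun x => conj (V.f x))
    (u' := rsF2) (v' := fun x => conj (V.f' x)) continuous_rsF1.continuousOn cv
    (fun x _ => hasDerivAt_rsF1 x) (fun x hx => hasDerivAt_conj_comp (hV.hasDeriv x hx))
    (continuous_rsF2.intervalIntegrable 0 1) (hI cv')
  rw [v1_1, v1_0, intervalIntegral.integral_add iD iE] at bpc
  -- (d) the Euler–Lagrange equation, integrated against v̄
  have e4 : ∫ x in (0:ℝ)..1, rsF4 x * conj (V.f x) =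
      -((5 * π ^ 2 / 2 : ℝ) : ℂ) * (∫ x in (0:ℝ)..1, rsF2 x * conj (V.f x))
        - ((9 * π ^ 4 / 16 : ℝ) : ℂ) * ∫ x in (0:ℝ)..1, rsF x * conj (V.f x) := by
    rw [← intervalIntegral.integral_const_mul, ← intervalIntegral.integral_const_mul,
      ← intervalIntegral.integral_sub (iD.const_mul _) (iF.const_mul _)]
    refine intervalIntegral.integral_congr fun x _ => ?_
    simp only [rsF_ode x]
    ring
  -- (e) split the bulk integral
  have e5 : ∫ x in (0:ℝ)..1, dnPolarIntegrand rsJet V x =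
      (∫ x in (0:ℝ)..1, rsF2 x * conj (V.f'' x))
        - ((5 * π ^ 2 / 2 : ℝ) : ℂ) * (∫ x in (0:ℝ)..1, rsF1 x * conj (V.f' x))
        + ((9 * π ^ 4 / 16 : ℝ) : ℂ) * ∫ x in (0:ℝ)..1, rsF x * conj (V.f x) := by
    rw [← intervalIntegral.integral_const_mul, ← intervalIntegral.integral_const_mul,
      ← intervalIntegral.integral_sub iB (iE.const_mul _),
      ← intervalIntegral.integral_add (iB.sub (iE.const_mul _)) (iF.const_mul _)]
    rfl
  rw [dnPolar, e5, dnBoundary]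
  simp only [rsJet]
  rw [v1, v1_1, v1_0]
  push_cast at bpa bpb bpc e4 ⊢
  linear_combination bpa - bpb - (5 * (π : ℂ) ^ 2 / 2) * bpc + e4

/-- `Q̃` is invariant under subtracting any multiple of the radical direction:
`Q̃(R − tR*, R − tR*) = Q̃(R, R)`. [folklore] -/
theorem dnPolar_subSmul_rsJet (hR : IsC2OnUnitInterval U.f U.f' U.f'') (t : ℂ) :
    dnPolar (U.subSmul t rsJet) (U.subSmul t rsJet) = dnPolar U U := by
  have hR₁ := Jet2.isC2_subSmul hR isC2_rsJet t
  rw [dnPolar_subSmul_left hR isC2_rsJet hR₁ t, dnPolar_rsJet_left hR₁, mul_zero, sub_zero,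
    dnPolar_subSmul_right hR hR isC2_rsJet t, dnPolar_swap rsJet U, dnPolar_rsJet_left hR,
    map_zero, mul_zero, sub_zero]

/-- The coefficient `t = −R′(1)/(2π)` that kills `R′(1)`. [folklore] -/
def rsCoeff (U : Jet2) : ℂ := -U.f' 1 / (2 * π)

/-- The reduced jet `R₁ = R − tR*`, `t = −R′(1)/(2π)`: it has `R₁(0) = R(0)` and `R₁′(1) = 0`.
[folklore] -/
def rsReduce (U : Jet2) : Jet2 := U.subSmul (rsCoeff U) rsJet

/-- `R₁(0) = R(0)`. [folklore] -/
theorem rsReduce_f_zero (U : Jet2) : (rsReduce U).f 0 = U.f 0 := by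
  simp [rsReduce, Jet2.subSmul, rsJet, rsF_values.1]

/-- `R₁′(1) = 0`. [folklore] -/
theorem rsReduce_f'_one (U : Jet2) : (rsReduce U).f' 1 = 0 := by
  have hπ : (π : ℂ) ≠ 0 := Complex.ofReal_ne_zero.mpr Real.pi_ne_zero
  simp only [rsReduce, Jet2.subSmul, rsJet, rsF_values.2.2.2.1, rsCoeff]
  field_simp
  ring

/-- `R₁` is `C²` if `R` is. [folklore] -/
theorem isC2_rsReduce (hU : IsC2OnUnitInterval U.f U.f' U.f'') :
    IsC2OnUnitInterval (rsReduce U).f (rsReduce U).f' (rsReduce U).f'' :=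
  Jet2.isC2_subSmul hU isC2_rsJet _

/-- **Reduction**: `Q̃(R,R) = Q(R₁)` — the form with boundary terms equals the Dirichlet–Neumann
form of the reduced jet (PROOF-O15 §3, first display). [folklore] -/
theorem dnPolar_self_eq_dnForm_rsReduce (hU : IsC2OnUnitInterval U.f U.f' U.f'') :
    dnPolar U U = (dnForm (rsReduce U).f (rsReduce U).f' (rsReduce U).f'' : ℂ) := by
  rw [← dnPolar_subSmul_rsJet hU (rsCoeff U)]
  exact dnPolar_self_eq_dnForm (isC2_rsReduce hU) (rsReduce_f'_one U)

/-- **`Q̃` is positive semidefinite on `{R ∈ C²[0,1] : R(0) = 0}`** and equals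
`∑_k π⁴(k−1)k(k+1)(k+2)|c_k(R₁)|²`. [folklore] -/
theorem dnPolar_self_hasSum (hU : IsC2OnUnitInterval U.f U.f' U.f'') (h0 : U.f 0 = 0) :
    HasSum (fun k : ℕ => dnWeight k * ‖qwCoeff (rsReduce U).f k‖ ^ 2) (dnPolar U U).re := by
  rw [dnPolar_self_eq_dnForm_rsReduce hU, Complex.ofReal_re]
  exact dnForm_hasSum (isC2_rsReduce hU) (by rw [rsReduce_f_zero]; exact h0) (rsReduce_f'_one U)

/-- `Q̃(R,R)` is real. [folklore] -/
theorem dnPolar_self_im (hU : IsC2OnUnitInterval U.f U.f' U.f'') : (dnPolar U U).im = 0 := by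
  rw [dnPolar_self_eq_dnForm_rsReduce hU, Complex.ofReal_im]

/-- **`Q̃(R,R) ≥ 0`** for `R ∈ C²[0,1]`, `R(0) = 0`. [folklore] -/
theorem dnPolar_self_re_nonneg (hU : IsC2OnUnitInterval U.f U.f' U.f'') (h0 : U.f 0 = 0) :
    0 ≤ (dnPolar U U).re :=
  (dnPolar_self_hasSum hU h0).nonneg fun k => mul_nonneg (dnWeight_nonneg k) (sq_nonneg _)

/-- **Kernel**: `Q̃(R,R) = 0 ↔ c_k(R₁) = 0` for all `k ≥ 2`, i.e. `R₁ ⊥ e_k` (`k ≥ 2`): in `L²`,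
`R₁ ∈ span{sin(πy/2), sin(3πy/2)}`, `R ∈ span{sin(πy/2), sin(3πy/2), R*}` (PROOF-O15 (T4)).
[folklore] -/
theorem dnPolar_self_re_eq_zero_iff (hU : IsC2OnUnitInterval U.f U.f' U.f'') (h0 : U.f 0 = 0) :
    (dnPolar U U).re = 0 ↔ ∀ k : ℕ, 2 ≤ k → qwCoeff (rsReduce U).f k = 0 := by
  rw [dnPolar_self_eq_dnForm_rsReduce hU, Complex.ofReal_re]
  exact dnForm_eq_zero_iff (isC2_rsReduce hU) (by rw [rsReduce_f_zero]; exact h0)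
    (rsReduce_f'_one U)


/-! ### Demodulation: the manuscript's main-term form `𝔅` is `(8/π)·Q̃` of the modulated primitive -/

/-- The demodulation frequency `c = 3π/2`. [folklore] -/
def modFreq : ℝ := 3 * π / 2

/-- The phase `E(y) = e^{icy}`, `c = 3π/2`. [folklore] -/
def modPhase (y : ℝ) : ℂ := Complex.exp (((modFreq * y : ℝ) : ℂ) * Complex.I)

/-- `|E(y)|² = 1`. [folklore] -/
theorem modPhase_mul_conj (y : ℝ) : modPhase y * conj (modPhase y) = 1 := by
  rw [Complex.mul_conj', modPhase, Complex.norm_exp_ofReal_mul_I]; simp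

/-- `E(0) = 1`. [folklore] -/
theorem modPhase_zero : modPhase 0 = 1 := by simp [modPhase]

/-- `E(1) = e^{3πi/2} = −i`. [folklore] -/
theorem modPhase_one : modPhase 1 = -Complex.I := by
  have hc : Real.cos (3 * π / 2) = 0 := by rw [← qwFreq_one]; exact cos_qwFreq 1
  have hs : Real.sin (3 * π / 2) = -1 := by rw [← qwFreq_one]; simpa using sin_qwFreq 1
  rw [modPhase, mul_one, Complex.exp_mul_I, ← Complex.ofReal_cos, ← Complex.ofReal_sin, modFreq,
    hc, hs]
  simp

/-- `E` is continuous. [folklore] -/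
theorem continuous_modPhase : Continuous modPhase := by unfold modPhase; fun_prop

/-- `E′ = icE`. [folklore] -/
theorem hasDerivAt_modPhase (y : ℝ) :
    HasDerivAt modPhase (Complex.I * modFreq * modPhase y) y := by
  have h1 : HasDerivAt (fun y : ℝ => modFreq * y) modFreq y := by
    simpa using (hasDerivAt_id y).const_mul modFreq
  have h3 : HasDerivAt (fun y : ℝ => ((modFreq * y : ℝ) : ℂ) * Complex.I)
      ((modFreq : ℂ) * Complex.I) y := h1.ofReal_comp.mul_const Complex.I
  have h4 := (Complex.hasDerivAt_exp _).comp y h3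
  refine h4.congr_deriv ?_
  simp only [modPhase]
  ring

/-- The modulated jet `R = E·S`, `R′ = E(S′ + icS)`, `R″ = E(S″ + 2icS′ − c²S)` of a jet
`P = (S, S′, S″)`. [folklore] -/
def Jet2.modulate (P : Jet2) : Jet2 :=
  ⟨fun y => modPhase y * P.f y,
    fun y => modPhase y * (P.f' y + Complex.I * modFreq * P.f y),
    fun y => modPhase y *
      (P.f'' y + 2 * (Complex.I * modFreq) * P.f' y - ((modFreq ^ 2 : ℝ) : ℂ) * P.f y)⟩

/-- Modulation preserves `C²`. [folklore] -/
theorem Jet2.isC2_modulate {P : Jet2} (hP : IsC2OnUnitInterval P.f P.f' P.f'') :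
    IsC2OnUnitInterval P.modulate.f P.modulate.f' P.modulate.f'' := by
  refine ⟨continuous_modPhase.continuousOn.mul hP.cont,
    continuous_modPhase.continuousOn.mul (hP.cont'.add (continuousOn_const.mul hP.cont)),
    continuous_modPhase.continuousOn.mul
      ((hP.cont''.add (continuousOn_const.mul hP.cont')).sub (continuousOn_const.mul hP.cont)),
    fun x hx => ?_, fun x hx => ?_⟩
  · have h : HasDerivAt (fun y => modPhase y * P.f y)
        (Complex.I * modFreq * modPhase x * P.f x + modPhase x * P.f' x) x :=
      (hasDerivAt_modPhase x).mul (hP.hasDeriv x hx)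
    refine h.congr_deriv ?_
    simp only [Jet2.modulate]
    ring
  · have h1 : HasDerivAt (fun y => P.f' y + Complex.I * modFreq * P.f y)
        (P.f'' x + Complex.I * modFreq * P.f' x) x :=
      (hP.hasDeriv' x hx).add ((hP.hasDeriv x hx).const_mul (Complex.I * modFreq))
    have h : HasDerivAt (fun y => modPhase y * (P.f' y + Complex.I * modFreq * P.f y))
        (Complex.I * modFreq * modPhase x * (P.f' x + Complex.I * modFreq * P.f x)
          + modPhase x * (P.f'' x + Complex.I * modFreq * P.f' x)) x :=
      (hasDerivAt_modPhase x).mul h1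
    refine h.congr_deriv ?_
    simp only [Jet2.modulate]
    push_cast
    linear_combination (modFreq : ℂ) ^ 2 * modPhase x * P.f x * Complex.I_mul_I

/-- `R(0) = 0` if `S(0) = 0`. [folklore] -/
theorem Jet2.modulate_f_zero {P : Jet2} (h0 : P.f 0 = 0) : P.modulate.f 0 = 0 := by
  simp [Jet2.modulate, h0]

/-- The demodulated integrand (the integrand of `Q̃(R,R)` with `|E|² = 1` divided out and the
`|S|²`-term gone, its coefficient `c⁴ − (5π²/2)c² + 9π⁴/16` being `0`). [folklore] -/
def demodIntegrand (P : Jet2) (x : ℝ) : ℂ :=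
  P.f'' x * conj (P.f'' x)
    - 2 * (Complex.I * modFreq) * (P.f'' x * conj (P.f' x))
    + 2 * (Complex.I * modFreq) * (P.f' x * conj (P.f'' x))
    + ((4 * modFreq ^ 2 - 5 * π ^ 2 / 2 : ℝ) : ℂ) * (P.f' x * conj (P.f' x))
    - ((modFreq ^ 2 : ℝ) : ℂ) * (P.f'' x * conj (P.f x) + P.f x * conj (P.f'' x))
    + Complex.I * ((5 * π ^ 2 / 2 * modFreq - 2 * modFreq ^ 3 : ℝ) : ℂ) *
      (P.f' x * conj (P.f x) - P.f x * conj (P.f' x))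

/-- Pointwise demodulation of the integrand. [folklore] -/
theorem dnPolarIntegrand_modulate (P : Jet2) (x : ℝ) :
    dnPolarIntegrand P.modulate P.modulate x = demodIntegrand P x := by
  have hE := modPhase_mul_conj x
  have key : dnPolarIntegrand P.modulate P.modulate x =
      modPhase x * conj (modPhase x) * demodIntegrand P x := by
    simp only [dnPolarIntegrand, Jet2.modulate, demodIntegrand, map_mul, map_add, map_sub,
      Complex.conj_ofReal, Complex.conj_I, map_ofNat, modFreq]
    push_cast
    linear_combination modPhase x * conj (modPhase x) *
      (-(4 * (3 * π / 2) ^ 2 : ℂ) * (P.f' x * conj (P.f' x))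
        + (5 * π ^ 2 / 2 * (3 * π / 2) ^ 2 : ℂ) * (P.f x * conj (P.f x))) * Complex.I_mul_I
  rw [key, hE, one_mul]

/-- `𝔅` in primitive coordinates `P = (S, g, g′)` (`S′ = g`): the manuscript's glued main-term
form (STRUCTURE.md (4.1) of the repair cell; PROOF-O15 §0)
`𝔅(g,g) = (8/π)‖g′‖² + 48 Im⟨g′,g⟩ + 88π‖g‖² + 48π² Im⟨S′,S⟩ − 24π Re(Ī(a₀+a₁)) + 16 Im(a₀ā₁)`,
`I = S(1)`, `a₀ = g(0)`, `a₁ = g(1)`, `⟨u,v⟩ = ∫₀¹ u v̄`. [folklore] -/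
def mainTermFormJet (P : Jet2) : ℝ :=
  8 / π * (∫ x in (0:ℝ)..1, ‖P.f'' x‖ ^ 2)
    + 48 * (∫ x in (0:ℝ)..1, P.f'' x * conj (P.f' x)).im
    + 88 * π * (∫ x in (0:ℝ)..1, ‖P.f' x‖ ^ 2)
    + 48 * π ^ 2 * (∫ x in (0:ℝ)..1, P.f' x * conj (P.f x)).im
    - 24 * π * (conj (P.f 1) * (P.f' 0 + P.f' 1)).re
    + 16 * (P.f' 0 * conj (P.f' 1)).im

/-- **(T1) Demodulation identity**: for a `C²` jet `P = (S, g, g′)` with `S(0) = 0`,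
`𝔅 = (8/π)·Re Q̃(R,R)` with `R = e^{3πiy/2}S` (PROOF-O15 §1). [folklore] -/
theorem mainTermFormJet_eq {P : Jet2} (hP : IsC2OnUnitInterval P.f P.f' P.f'') (h0 : P.f 0 = 0) :
    mainTermFormJet P = 8 / π * (dnPolar P.modulate P.modulate).re := by
  have hI : ∀ {h : ℝ → ℂ}, ContinuousOn h (Icc 0 1) → IntervalIntegrable h volume 0 1 :=
    fun hh => hh.intervalIntegrable_of_Icc zero_le_one
  have c0 := continuousOn_conj_comp hP.cont
  have c1 := continuousOn_conj_comp hP.cont'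
  have c2 := continuousOn_conj_comp hP.cont''
  -- the eight basic integrands
  have i22 : IntervalIntegrable (fun x => P.f'' x * conj (P.f'' x)) volume 0 1 := hI (hP.cont''.mul c2)
  have i21 : IntervalIntegrable (fun x => P.f'' x * conj (P.f' x)) volume 0 1 := hI (hP.cont''.mul c1)
  have i12 : IntervalIntegrable (fun x => P.f' x * conj (P.f'' x)) volume 0 1 := hI (hP.cont'.mul c2)
  have i11 : IntervalIntegrable (fun x => P.f' x * conj (P.f' x)) volume 0 1 := hI (hP.cont'.mul c1)
  have i20 : IntervalIntegrable (fun x => P.f'' x * conj (P.f x)) volume 0 1 := hI (hP.cont''.mul c0)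
  have i02 : IntervalIntegrable (fun x => P.f x * conj (P.f'' x)) volume 0 1 := hI (hP.cont.mul c2)
  have i10 : IntervalIntegrable (fun x => P.f' x * conj (P.f x)) volume 0 1 := hI (hP.cont'.mul c0)
  have i01 : IntervalIntegrable (fun x => P.f x * conj (P.f' x)) volume 0 1 := hI (hP.cont.mul c1)
  have iG1 : IntervalIntegrable (fun x => P.f'' x * conj (P.f x) + P.f x * conj (P.f'' x))
      volume 0 1 := i20.add i02
  have iG2 : IntervalIntegrable (fun x => P.f' x * conj (P.f x) - P.f x * conj (P.f' x))
      volume 0 1 := i10.sub i01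
  -- split the bulk integral into six pieces
  have split : ∫ x in (0:ℝ)..1, demodIntegrand P x =
      (∫ x in (0:ℝ)..1, P.f'' x * conj (P.f'' x))
      + (-(2 * (Complex.I * modFreq))) * (∫ x in (0:ℝ)..1, P.f'' x * conj (P.f' x))
      + (2 * (Complex.I * modFreq)) * (∫ x in (0:ℝ)..1, P.f' x * conj (P.f'' x))
      + ((4 * modFreq ^ 2 - 5 * π ^ 2 / 2 : ℝ) : ℂ) * (∫ x in (0:ℝ)..1, P.f' x * conj (P.f' x))
      + (-((modFreq ^ 2 : ℝ) : ℂ)) *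
          (∫ x in (0:ℝ)..1, (P.f'' x * conj (P.f x) + P.f x * conj (P.f'' x)))
      + (Complex.I * ((5 * π ^ 2 / 2 * modFreq - 2 * modFreq ^ 3 : ℝ) : ℂ)) *
          (∫ x in (0:ℝ)..1, (P.f' x * conj (P.f x) - P.f x * conj (P.f' x))) := by
    have a1 : IntervalIntegrable (fun x => P.f'' x * conj (P.f'' x)
        + (-(2 * (Complex.I * modFreq))) * (P.f'' x * conj (P.f' x))) volume 0 1 :=
      i22.add (i21.const_mul _)
    have a2 : IntervalIntegrable (fun x => P.f'' x * conj (P.f'' x)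
        + (-(2 * (Complex.I * modFreq))) * (P.f'' x * conj (P.f' x))
        + (2 * (Complex.I * modFreq)) * (P.f' x * conj (P.f'' x))) volume 0 1 :=
      a1.add (i12.const_mul _)
    have a3 : IntervalIntegrable (fun x => P.f'' x * conj (P.f'' x)
        + (-(2 * (Complex.I * modFreq))) * (P.f'' x * conj (P.f' x))
        + (2 * (Complex.I * modFreq)) * (P.f' x * conj (P.f'' x))
        + ((4 * modFreq ^ 2 - 5 * π ^ 2 / 2 : ℝ) : ℂ) * (P.f' x * conj (P.f' x))) volume 0 1 :=
      a2.add (i11.const_mul _)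
    have a4 : IntervalIntegrable (fun x => P.f'' x * conj (P.f'' x)
        + (-(2 * (Complex.I * modFreq))) * (P.f'' x * conj (P.f' x))
        + (2 * (Complex.I * modFreq)) * (P.f' x * conj (P.f'' x))
        + ((4 * modFreq ^ 2 - 5 * π ^ 2 / 2 : ℝ) : ℂ) * (P.f' x * conj (P.f' x))
        + (-((modFreq ^ 2 : ℝ) : ℂ)) * (P.f'' x * conj (P.f x) + P.f x * conj (P.f'' x)))
        volume 0 1 :=
      a3.add (iG1.const_mul _)
    rw [← intervalIntegral.integral_const_mul, ← intervalIntegral.integral_const_mul,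
      ← intervalIntegral.integral_const_mul, ← intervalIntegral.integral_const_mul,
      ← intervalIntegral.integral_const_mul,
      ← intervalIntegral.integral_add i22 (i21.const_mul _),
      ← intervalIntegral.integral_add a1 (i12.const_mul _),
      ← intervalIntegral.integral_add a2 (i11.const_mul _),
      ← intervalIntegral.integral_add a3 (iG1.const_mul _),
      ← intervalIntegral.integral_add a4 (iG2.const_mul _)]
    refine intervalIntegral.integral_congr fun x _ => ?_
    simp only [demodIntegrand]
    ring
  -- conjugate pairs
  have rX : ∫ x in (0:ℝ)..1, P.f' x * conj (P.f'' x) =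
      conj (∫ x in (0:ℝ)..1, P.f'' x * conj (P.f' x)) := by
    rw [← intervalIntegral_conj]
    refine intervalIntegral.integral_congr fun x _ => ?_
    simp only [map_mul, Complex.conj_conj]
    ring
  have rY : ∫ x in (0:ℝ)..1, (P.f' x * conj (P.f x) - P.f x * conj (P.f' x)) =
      ((2 * (∫ x in (0:ℝ)..1, P.f' x * conj (P.f x)).im : ℝ) : ℂ) * Complex.I := by
    rw [intervalIntegral.integral_sub i10 i01, ← Complex.sub_conj, ← intervalIntegral_conj]
    congr 1
    refine intervalIntegral.integral_congr fun x _ => ?_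
    simp only [map_mul, Complex.conj_conj]
    ring
  -- the two by-parts identities ∫ g′S̄ = a₁Ī − ‖g‖², ∫ S ḡ′ = I ā₁ − ‖g‖²
  have bpZ := integral_deriv_mul_unitInterval (u := P.f') (v := fun x => conj (P.f x))
    (u' := P.f'') (v' := fun x => conj (P.f' x)) hP.cont' c0 hP.hasDeriv'
    (fun x hx => hasDerivAt_conj_comp (hP.hasDeriv x hx)) (hI hP.cont'') (hI c1)
  rw [h0, intervalIntegral.integral_add i20 i11] at bpZ
  have bpZc := integral_deriv_mul_unitInterval (u := P.f) (v := fun x => conj (P.f' x))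
    (u' := P.f') (v' := fun x => conj (P.f'' x)) hP.cont c1 hP.hasDeriv
    (fun x hx => hasDerivAt_conj_comp (hP.hasDeriv' x hx)) (hI hP.cont') (hI c2)
  rw [h0, intervalIntegral.integral_add i11 i02] at bpZc
  have rG1 : ∫ x in (0:ℝ)..1, (P.f'' x * conj (P.f x) + P.f x * conj (P.f'' x)) =
      P.f' 1 * conj (P.f 1) + P.f 1 * conj (P.f' 1)
        - 2 * ∫ x in (0:ℝ)..1, P.f' x * conj (P.f' x) := by
    rw [intervalIntegral.integral_add i20 i02]
    simp only [map_zero, mul_zero, zero_mul, sub_zero] at bpZ bpZc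
    linear_combination bpZ + bpZc
  -- real Gram integrals
  have r2 := integral_mul_conj_eq_ofReal P.f''
  have r1 := integral_mul_conj_eq_ofReal P.f'
  -- assemble
  have hπ : π ≠ 0 := Real.pi_ne_zero
  rw [mainTermFormJet, dnPolar, intervalIntegral.integral_congr (fun x _ => dnPolarIntegrand_modulate P x),
    split, rX, rY, rG1, r2, r1, dnBoundary]
  simp only [Jet2.modulate, modPhase_zero, modPhase_one, h0, modFreq, mul_zero, add_zero, one_mul]
  simp only [Complex.add_re, Complex.sub_re, Complex.mul_re, Complex.neg_re, Complex.add_im,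
    Complex.sub_im, Complex.mul_im, Complex.neg_im, Complex.ofReal_re, Complex.ofReal_im,
    Complex.I_re, Complex.I_im, Complex.conj_re, Complex.conj_im, Complex.re_ofNat,
    Complex.im_ofNat, mul_zero, zero_mul, add_zero, sub_zero, mul_one]
  field_simp
  ring

/-- **PSD of the main-term form in primitive coordinates.** [folklore] -/
theorem mainTermFormJet_nonneg {P : Jet2} (hP : IsC2OnUnitInterval P.f P.f' P.f'')
    (h0 : P.f 0 = 0) : 0 ≤ mainTermFormJet P := by
  rw [mainTermFormJet_eq hP h0]
  exact mul_nonneg (div_nonneg (by norm_num) Real.pi_pos.le)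
    (dnPolar_self_re_nonneg (Jet2.isC2_modulate hP) (Jet2.modulate_f_zero h0))

/-! ### The form on `C¹` profiles `g` -/

/-- `g ∈ C¹[0,1]` with marked derivative `g′`. [folklore] -/
structure IsC1OnUnitInterval (g g' : ℝ → ℂ) : Prop where
  cont : ContinuousOn g (Icc 0 1)
  cont' : ContinuousOn g' (Icc 0 1)
  hasDeriv : ∀ x ∈ Ioo (0:ℝ) 1, HasDerivAt g (g' x) x

/-- The primitive jet `(S, g, g′)`, `S(y) = ∫₀ʸ g`. [folklore] -/
def primitiveJet (g g' : ℝ → ℂ) : Jet2 := ⟨fun y => ∫ t in (0:ℝ)..y, g t, g, g'⟩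

/-- `S(0) = 0`. [folklore] -/
theorem primitiveJet_f_zero (g g' : ℝ → ℂ) : (primitiveJet g g').f 0 = 0 := by
  simp [primitiveJet]

/-- The primitive jet of a `C¹` profile is `C²` (fundamental theorem of calculus). [folklore] -/
theorem isC2_primitiveJet {g g' : ℝ → ℂ} (hg : IsC1OnUnitInterval g g') :
    IsC2OnUnitInterval (primitiveJet g g').f (primitiveJet g g').f' (primitiveJet g g').f'' := by
  refine ⟨?_, hg.cont, hg.cont', fun x hx => ?_, hg.hasDeriv⟩
  · have h : ContinuousOn (fun y => ∫ t in (0:ℝ)..y, g t) (uIcc 0 1) :=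
      intervalIntegral.continuousOn_primitive_interval
        (by rw [uIcc_of_le zero_le_one]; exact hg.cont.integrableOn_Icc)
    rwa [uIcc_of_le zero_le_one] at h
  · have hint : IntervalIntegrable g volume 0 x :=
      (hg.cont.mono (Icc_subset_Icc_right hx.2.le)).intervalIntegrable_of_Icc hx.1.le
    have hmeas : StronglyMeasurableAtFilter g (nhds x) volume :=
      ContinuousOn.stronglyMeasurableAtFilter isOpen_Ioo (hg.cont.mono Ioo_subset_Icc_self) x hx
    have hcont : ContinuousAt g x := hg.cont.continuousAt (Icc_mem_nhds hx.1 hx.2)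
    exact intervalIntegral.integral_hasDerivAt_right hint hmeas hcont

/-- **The manuscript's main-term form** `𝔅(g,g)` for a profile `g : [0,1] → ℂ` with derivative
`g′` (STRUCTURE.md (4.1); PROOF-O15 §0):
`(8/π)‖g′‖² + 48 Im⟨g′,g⟩ + 88π‖g‖² + 48π² Im⟨g,S⟩ − 24π Re(Ī(g(0)+g(1))) + 16 Im(g(0) conj g(1))`
with `S(y) = ∫₀ʸ g`, `I = S(1)`. [folklore] -/
def mainTermForm (g g' : ℝ → ℂ) : ℝ := mainTermFormJet (primitiveJet g g')

/-- Unfolded formula for `𝔅(g,g)`. [folklore] -/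
theorem mainTermForm_eq (g g' : ℝ → ℂ) : mainTermForm g g' =
    8 / π * (∫ x in (0:ℝ)..1, ‖g' x‖ ^ 2)
    + 48 * (∫ x in (0:ℝ)..1, g' x * conj (g x)).im
    + 88 * π * (∫ x in (0:ℝ)..1, ‖g x‖ ^ 2)
    + 48 * π ^ 2 * (∫ x in (0:ℝ)..1, g x * conj (∫ t in (0:ℝ)..x, g t)).im
    - 24 * π * (conj (∫ t in (0:ℝ)..1, g t) * (g 0 + g 1)).re
    + 16 * (g 0 * conj (g 1)).im := rfl

/-- **O15 (T1)–(T3): `𝔅` is positive semidefinite on `C¹[0,1]`.** [folklore] -/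
theorem mainTermForm_nonneg {g g' : ℝ → ℂ} (hg : IsC1OnUnitInterval g g') :
    0 ≤ mainTermForm g g' :=
  mainTermFormJet_nonneg (isC2_primitiveJet hg) (primitiveJet_f_zero g g')

/-- **O15: `𝔅(g,g)` as a weighted sum of squares** —
`𝔅(g,g) = (8/π) ∑ₖ π⁴(k−1)k(k+1)(k+2)|c_k(R₁)|²`, `R₁` the reduced modulated primitive,
`c_k` its quarter-wave sine coefficients (PROOF-O15 (T2)). [folklore] -/
theorem mainTermForm_hasSum {g g' : ℝ → ℂ} (hg : IsC1OnUnitInterval g g') :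
    HasSum (fun k : ℕ => 8 / π * (dnWeight k *
      ‖qwCoeff (rsReduce (primitiveJet g g').modulate).f k‖ ^ 2)) (mainTermForm g g') := by
  rw [mainTermForm, mainTermFormJet_eq (isC2_primitiveJet hg) (primitiveJet_f_zero g g')]
  exact (dnPolar_self_hasSum (Jet2.isC2_modulate (isC2_primitiveJet hg))
    (Jet2.modulate_f_zero (primitiveJet_f_zero g g'))).mul_left _

/-- **O15 (T4), coefficient form of the kernel**: `𝔅(g,g) = 0` iff all quarter-wave coefficients
`c_k(R₁)`, `k ≥ 2`, of the reduced modulated primitive vanish. [folklore] -/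
theorem mainTermForm_eq_zero_iff {g g' : ℝ → ℂ} (hg : IsC1OnUnitInterval g g') :
    mainTermForm g g' = 0 ↔
      ∀ k : ℕ, 2 ≤ k → qwCoeff (rsReduce (primitiveJet g g').modulate).f k = 0 := by
  rw [mainTermForm, mainTermFormJet_eq (isC2_primitiveJet hg) (primitiveJet_f_zero g g'),
    mul_eq_zero, or_iff_right (div_ne_zero (by norm_num) Real.pi_ne_zero)]
  exact dnPolar_self_re_eq_zero_iff (Jet2.isC2_modulate (isC2_primitiveJet hg))
    (Jet2.modulate_f_zero (primitiveJet_f_zero g g'))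

end Literature.NumberTheory.LFunctions.Zhang2022
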